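import Literature.Probability.RandomPlanarGeometry.ChordalCurveFamilyProofs
import Literature.Probability.RandomPlanarGeometry.ChordalKSCondition
import Literature.Probability.RandomPlanarGeometry.ConformalRestrictionProofs
import Literature.Probability.RandomPlanarGeometry.CaratheodoryHalfPlaneProofs
import Literature.Probability.RandomPlanarGeometry.LocalMartingaleProofs
import Literature.Probability.RandomPlanarGeometry.SLEUniquenessInLaw
import HarnessLib

/-!
# Locality of chordal SLE₆, restriction form (Lawler–Schramm–Werner 2001), for SLE₆ laws

Topic `Probability/RandomPlanarGeometry`. The **restriction form of the locality property of
chordal SLE₆** (G. F. Lawler, O. Schramm, W. Werner, *Values of Brownian intersection exponents I: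
Half-plane exponents*, Acta Math. **187** (2001) 237–273, §2: Thm. 2.2 (locality) and Cor. 2.4
(restriction property); arXiv:math/9911084, Thm. 3 / Cor. 5), transposed to the tree's chordal
SLE laws `IsSLELaw 6 D μ` of Dobrushin (two-marked Jordan) domains and to curves modulo
reparametrisation, exactly in the form consumed by `ChordalFamily.IsLocal`
(`ChordalCurveFamily.lean`):

* `IsSLELaw.locality_six` — NAMED FACT (the theorem itself, as a `Prop`);
* `ChordalFamily.isLocal_of_isSLELaw_six` — a family of chordal SLE₆ laws is local
  (`ChordalFamily.IsLocal`), given the fact;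
* `IsSLELaw.measure_preimage_stopAt_of_pt_mem`, `IsSLELaw.locality_clause_of_pt_mem` — the
  **degenerate case proved unconditionally** (any `κ`): if `a = D.pt 0 ∈ F` then under any chordal
  SLE law of a domain with first marked point `a` the stopped class is a.s. the constant class at
  `a`, so both sides of the locality identity equal `𝟙_T (mk (const a))`;
* `IsSLELaw.of_carrier_eq`, `CurveClass.stopAt_empty`, `IsSLELaw.locality_clause_of_carrier_eq`
  — the **case of equal carriers proved unconditionally** (any `κ`): an SLE law depends on the
  Dobrushin domain only through `(carrier, a, b)`, stopping on `F = closure ∅ = ∅` does nothing,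
  and two SLE_κ laws of the same `(carrier, a, b)` coincide (`IsSLELaw.unique'`, uniqueness in
  law, proved in the tree); this is the instance of locality saying that the law does not depend
  on the parametrisation of `∂D`;
* `IsSLELaw.locality_six_of_nondegenerate` — hence the fact reduces to the non-degenerate case
  `a ∉ closure (D ∖ D')`, `D' ≠ D` as sets (the domains agree near `a` and differ somewhere),
  which is the printed theorem.

## The printed statements and the transposition

[LSW 2001, Cor. 2.4 (= arXiv Cor. 5, "Restriction property")]: "Let `D* ⊂ D` denote two simply
connected domains, and assume that `∂D` is a Jordan curve. Suppose that `I := ∂D* ∖ ∂D` is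
connected. Take two distinct points `a` and `b` in `∂D ∩ ∂D* ∖ \bar I`. Let `(K_t, t ≥ 0)` denote
SLE₆ from `a` to `b` in `D`, and `T := sup{t : \bar K_t ∩ I = ∅}`. Similarly, let `(K*_t, t ≥ 0)`
be SLE₆ from `a` to `b` in `D*`, and `T* := sup{t : \bar K*_t ∩ I = ∅}`. Then `(K_t, t < T)` and
`(K*_t, t < T*)` have the same law up to time-change." It is deduced there from the local
version, Thm. 2.2 (= arXiv Thm. 3, "Locality"): for `f : D → ℍ` conformal, `N` a neighbourhood
of `0` in `ℍ` cut out by a nice path, `D* = f⁻¹(N)`, `f* = ψ_N ∘ f`, "the law of `(K_t, t < τ)` is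
that of a time-change of `(K*_t, t < τ*)`", `τ, τ*` the hitting times of `∂D* ∩ D`; the authors
add "For convenience only, we will state them [the corollaries] under some assumptions on the
boundaries of the domains."

Transposition (dictionary of `ChordalFamily.IsLocal`): the SLE₆ *process* of `(D; a, b)` is
replaced by its law `μ` on curve classes (`IsSLELaw 6 D μ`: image of the SLE₆ trace under the
boundary extension of a chordal uniformizing map, time-compactified — Rohde–Schramm); "law of
`(K_t, t < T)` up to time-change" becomes the law of the class of the initial segment
`CurveClass.stopAt F` up to the first hitting of the closed set `F := closure (D ∖ D*) ⊇ I`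
(curve classes ARE curves up to time-change, so no time-change bookkeeping remains; for a curve in
`\bar{D*}`, resp. in `\bar D` before it meets `F`, hitting `F` is hitting `\bar I`); laws of
stopped classes are compared on `stopAt F ⁻¹' T`, `T` Borel. The fact is stated for ALL pairs of
Dobrushin domains `D* ⊆ D` with the same marked points, as `ChordalFamily.IsLocal` is: when
`a ∈ F` both stopped classes are a.s. the constant class at `a` and the identity is proved below
(`IsSLELaw.locality_clause_of_pt_mem`); when `a ∉ F` the domains agree near `a` and the identity is
the content of Thm. 2.2 (with `I` not necessarily connected and `b` possibly in `\bar I`, covered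
by the local theorem together with the approximation remark quoted above; see also Lawler (2005),
§6.3, Prop. 6.13–6.14, and Werner (2007), §3.3).

## Not here

The discharge `IsSLELaw.locality_six_holds` (Itô computation `dW̃ = h_t'(W) dW + (κ/2 - 3)
h_t''(W) dt`, driftless at `κ = 6`, time change, identification of the image Loewner chain) is
not in this file; the SLE₆ family is therefore `IsLocal` conditionally on the named fact.

## Mathlib / tree

Mathlib: `measure_congr`, `Filter.eventuallyEq_univ`, `measure_eq_zero_iff_ae_notMem`,
`Set.projIcc_left`. Tree: `IsSLELaw`, `IsSLELaw.ae_endpoints`, `IsSLELaw.isProbabilityMeasure`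
(SLE.lean, ConformalRestrictionProofs.lean), `IsSLELaw.unique'` (SLEUniquenessInLaw.lean),
`JordanDomain.mapsTo_boundaryExtension_holds` (Carathéodory),
`isProjectiveLimit_preWienerMeasure_holds` (Kolmogorov), `ChordalFamily.IsLocal`, `Curve.stopAt`,
`CurveClass.stopAt` (ChordalCurveFamily.lean), `CurveClass.stopAt_eq_of_source_mem` (a class
starting inside `F` is stopped at once, ChordalKSCondition.lean). No SLE in Mathlib.
-/

noncomputable section

open Set Filter MeasureTheory Topology
open UpperHalfPlane (upperHalfPlaneSet)
open scoped unitInterval NNReal ENNReal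

namespace Literature.Probability.RandomPlanarGeometry

/-! ### The named fact and the locality of the SLE₆ family -/

/-- NAMED FACT — **[LSW 2001] Thm. 2.2 (locality of SLE₆) with Cor. 2.4 (restriction form),
transposed to chordal SLE₆ laws of Dobrushin domains.** Printed (Cor. 2.4): "Let `D* ⊂ D` denote
two simply connected domains, and assume that `∂D` is a Jordan curve. Suppose that
`I := ∂D* ∖ ∂D` is connected. Take two distinct points `a` and `b` in `∂D ∩ ∂D* ∖ \bar I`. Let
`(K_t, t ≥ 0)` denote SLE₆ from `a` to `b` in `D`, and `T := sup{t : \bar K_t ∩ I = ∅}`.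
Similarly, let `(K*_t, t ≥ 0)` be SLE₆ from `a` to `b` in `D*`, and
`T* := sup{t : \bar K*_t ∩ I = ∅}`. Then `(K_t, t < T)` and `(K*_t, t < T*)` have the same law
up to time-change." Transposed with the dictionary of the module docstring (the one of
`ChordalFamily.IsLocal`): if `μ`, `μ'` are chordal SLE₆ laws of Dobrushin domains `D' ⊆ D` with
the same marked points `a = pt 0`, `b = pt 1`, then the classes of the two curves stopped at their
first hitting of `F = closure (D ∖ D')` have the same law,
`μ' (stopAt F ⁻¹' T) = μ (stopAt F ⁻¹' T)` for every Borel `T`. (For `a ∈ F` this is proved below,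
`IsSLELaw.locality_clause_of_pt_mem`; the content is the case `a ∉ F`, Thm. 2.2.)
[cite: LawlerSchrammWerner2001, Thm 2.2 and Cor 2.4] -/
def IsSLELaw.locality_six : Prop :=
  ∀ (D D' : DobrushinDomain) {μ μ' : Measure (CurveClass ℂ)},
    IsSLELaw 6 D μ → IsSLELaw 6 D' μ' → D'.carrier ⊆ D.carrier → D'.pt 0 = D.pt 0 →
    D'.pt 1 = D.pt 1 → ∀ T : Set (CurveClass ℂ), MeasurableSet T →
      μ' (CurveClass.stopAt (closure (D.carrier \ D'.carrier)) ⁻¹' T) =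
        μ (CurveClass.stopAt (closure (D.carrier \ D'.carrier)) ⁻¹' T)

/-- **A family of chordal SLE₆ laws is local** (restriction form of locality,
`ChordalFamily.IsLocal`), given the named fact `IsSLELaw.locality_six` (hypothesis `h`).
[cite: LawlerSchrammWerner2001, Cor 2.4] -/
theorem ChordalFamily.isLocal_of_isSLELaw_six (h : IsSLELaw.locality_six) {Q : ChordalFamily}
    (hQ : ∀ D : DobrushinDomain, IsSLELaw 6 D (Q D)) : Q.IsLocal :=
  fun D D' hsub h0 h1 T hT => h D D' (hQ D) (hQ D') hsub h0 h1 T hT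

/-! ### Stopping on the empty set -/

namespace CurveClass

variable {E : Type*} [MetricSpace E]

/-- Stopping on the empty set does nothing. [folklore] -/
@[simp] theorem stopAt_empty (c : CurveClass E) : stopAt ∅ c = c := by
  rw [stopAt, Curve.stopAt_eq_self_of_hitParam_eq_one
    (Curve.hitParam_eq_one_of_forall_notMem fun _ => Set.notMem_empty _), mk_out]

end CurveClass

/-! ### The degenerate case `a ∈ F`, unconditionally -/

section Degenerate

variable {κ : ℝ≥0}

/-- Under a chordal SLE_κ law of `(D; a, b)`, if `a ∈ F` then the measure of `stopAt F ⁻¹' T` is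
the indicator `𝟙_T (mk (const a))` (`1` or `0` according as the constant class at `a` lies in `T`
or not): `μ`-a.e. class starts at `a` (`IsSLELaw.ae_endpoints`, Carathéodory) hence is stopped at
once, and `μ` is a probability measure (Kolmogorov extension for the pre-Wiener measure). [folklore] -/
theorem IsSLELaw.measure_preimage_stopAt_of_pt_mem {D : DobrushinDomain}
    {μ : Measure (CurveClass ℂ)} (hμ : IsSLELaw κ D μ) {F : Set ℂ} (ha : D.pt 0 ∈ F)
    (T : Set (CurveClass ℂ)) :
    μ (CurveClass.stopAt F ⁻¹' T) = T.indicator 1 (CurveClass.mk (Curve.const (D.pt 0))) := by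
  haveI : Fact Process.isProjectiveLimit_preWienerMeasure :=
    ⟨isProjectiveLimit_preWienerMeasure_holds⟩
  haveI := hμ.isProbabilityMeasure
  have h2 : ∀ᵐ γ ∂μ, γ ∈ CurveClass.stopAt F ⁻¹' T ↔ CurveClass.mk (Curve.const (D.pt 0)) ∈ T := by
    filter_upwards [hμ.ae_endpoints JordanDomain.mapsTo_boundaryExtension_holds] with γ hγ
    rw [mem_preimage, CurveClass.stopAt_eq_of_source_mem (hγ.1.symm ▸ ha), hγ.1]
  by_cases hT : CurveClass.mk (Curve.const (D.pt 0)) ∈ T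
  · have h : CurveClass.stopAt F ⁻¹' T =ᵐ[μ] (univ : Set (CurveClass ℂ)) :=
      Filter.eventuallyEq_univ.2 (by filter_upwards [h2] with γ hγ using hγ.2 hT)
    rw [measure_congr h, measure_univ, indicator_of_mem hT, Pi.one_apply]
  · rw [indicator_of_notMem hT]
    exact measure_eq_zero_iff_ae_notMem.2
      (by filter_upwards [h2] with γ hγ using fun h => hT (hγ.1 h))

/-- **The degenerate case of locality, proved (any `κ`).** If two Dobrushin domains have the same
first marked point `a` and `a ∈ F`, then the classes stopped on `F` have the same law under any
chordal SLE_κ laws of the two domains (both are a.s. the constant class at `a`). In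
`IsSLELaw.locality_six` this is the case `a ∈ closure (D ∖ D')` ("`D`, `D'` do not agree near
`a`"), where the printed theorem says nothing and the typed clause holds trivially. [folklore] -/
theorem IsSLELaw.locality_clause_of_pt_mem {D D' : DobrushinDomain} {μ μ' : Measure (CurveClass ℂ)}
    (hμ : IsSLELaw κ D μ) (hμ' : IsSLELaw κ D' μ') (h0 : D'.pt 0 = D.pt 0) {F : Set ℂ}
    (ha : D.pt 0 ∈ F) (T : Set (CurveClass ℂ)) :
    μ' (CurveClass.stopAt F ⁻¹' T) = μ (CurveClass.stopAt F ⁻¹' T) := by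
  rw [hμ'.measure_preimage_stopAt_of_pt_mem (by rw [h0]; exact ha) T,
    hμ.measure_preimage_stopAt_of_pt_mem ha T, h0]

end Degenerate

/-! ### The case of equal carriers, unconditionally -/

section Carrier

variable {κ : ℝ≥0}

/-- **An SLE law depends on the Dobrushin domain only through its carrier and its two marked
points**: if `D`, `D'` have the same carrier, the same `a` and the same `b` (but possibly
different parametrisations of the boundary loop), an SLE_κ law of `D` is an SLE_κ law of `D'`
(the chordal uniformizing map and the compactified image of the trace are the same objects).
Lawler (2005), §6.3. [folklore] -/
theorem IsSLELaw.of_carrier_eq {D D' : DobrushinDomain} {μ : Measure (CurveClass ℂ)}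
    (h : IsSLELaw κ D μ) (hc : D'.carrier = D.carrier) (h0 : D'.pt 0 = D.pt 0)
    (h1 : D'.pt 1 = D.pt 1) : IsSLELaw κ D' μ := by
  obtain ⟨Γ, ⟨hΓm, φ, hφ, hae⟩, rfl⟩ := h
  let φ' : ConformalEquiv upperHalfPlaneSet D'.carrier :=
    { toPartialEquiv := φ.toPartialEquiv
      source_eq := φ.source_eq
      target_eq := φ.target_eq.trans hc.symm
      differentiableOn := φ.differentiableOn
      differentiableOn_symm := by rw [hc]; exact φ.differentiableOn_symm }
  refine ⟨Γ, ⟨hΓm, φ', ⟨?_, ?_⟩, ?_⟩, rfl⟩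
  · show Tendsto φ (𝓝[upperHalfPlaneSet] 0) (𝓝 (D'.pt 0))
    rw [h0]
    exact hφ.1
  · show Tendsto φ (cocompact ℂ ⊓ 𝓟 upperHalfPlaneSet) (𝓝 (D'.pt 1))
    rw [h1]
    exact hφ.2
  · have hb : φ'.boundaryExtension = φ.boundaryExtension := rfl
    filter_upwards [hae] with ω ⟨hgen, c, hc', hcomp⟩
    exact ⟨hgen, c, hc', by rw [hb, h1]; exact hcomp⟩

/-- **The case of equal carriers of locality, proved (any `κ`).** If `D`, `D'` have the same
carrier and the same marked points then `F = closure (D ∖ D') = ∅`, stopping on `F` does nothing,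
and the locality identity says that the two SLE_κ laws agree — which they do, by uniqueness in
law of chordal SLE_κ in `(carrier; a, b)` (`IsSLELaw.unique'`, Lawler (2005), §6.1/6.3).
[folklore] -/
theorem IsSLELaw.locality_clause_of_carrier_eq {D D' : DobrushinDomain}
    {μ μ' : Measure (CurveClass ℂ)} (hμ : IsSLELaw κ D μ) (hμ' : IsSLELaw κ D' μ')
    (hc : D'.carrier = D.carrier) (h0 : D'.pt 0 = D.pt 0) (h1 : D'.pt 1 = D.pt 1)
    (T : Set (CurveClass ℂ)) :
    μ' (CurveClass.stopAt (closure (D.carrier \ D'.carrier)) ⁻¹' T) =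
      μ (CurveClass.stopAt (closure (D.carrier \ D'.carrier)) ⁻¹' T) := by
  rw [hc, sdiff_self, hμ.unique' (hμ'.of_carrier_eq hc.symm h0.symm h1.symm)]

end Carrier

/-! ### Reduction to the non-degenerate case -/

/-- **Reduction of the named fact to the non-degenerate case.** `IsSLELaw.locality_six` follows
from its restriction to pairs `D' ⊆ D` that agree near `a`, i.e. `a ∉ closure (D ∖ D')` — the
printed hypothesis `a ∉ \bar I` of [LSW 2001] Cor. 2.4 — and have different carriers (so that
`I = ∂D' ∩ D ≠ ∅`). [cite: LawlerSchrammWerner2001, Cor 2.4] -/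
theorem IsSLELaw.locality_six_of_nondegenerate
    (h : ∀ (D D' : DobrushinDomain) {μ μ' : Measure (CurveClass ℂ)},
      IsSLELaw 6 D μ → IsSLELaw 6 D' μ' → D'.carrier ⊆ D.carrier → D'.carrier ≠ D.carrier →
      D'.pt 0 = D.pt 0 → D'.pt 1 = D.pt 1 → D.pt 0 ∉ closure (D.carrier \ D'.carrier) →
      ∀ T : Set (CurveClass ℂ), MeasurableSet T →
        μ' (CurveClass.stopAt (closure (D.carrier \ D'.carrier)) ⁻¹' T) =
          μ (CurveClass.stopAt (closure (D.carrier \ D'.carrier)) ⁻¹' T)) :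
    IsSLELaw.locality_six := by
  intro D D' μ μ' hμ hμ' hsub h0 h1 T hT
  by_cases ha : D.pt 0 ∈ closure (D.carrier \ D'.carrier)
  · exact hμ.locality_clause_of_pt_mem hμ' h0 ha T
  by_cases hc : D'.carrier = D.carrier
  · exact hμ.locality_clause_of_carrier_eq hμ' hc h0 h1 T
  · exact h D D' hμ hμ' hsub hc h0 h1 ha T hT

end Literature.Probability.RandomPlanarGeometry

end
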